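import Summits.CriticalPhenomena.PercolationContinuityZ3.Theses.PercLowPointHalfSpace
import Literature.Probability.Percolation.FiniteEnergy
import Literature.Probability.Percolation.CriticalContinuityProofs
import Literature.Probability.Percolation.SharpnessDCTProofs
import Literature.Probability.Percolation.LatticeSymmetry
import Literature.Probability.Percolation.InequalitiesProofs
import Literature.Probability.Percolation.InsertionTolerance

/-!
# Disproof work file — crux `BoundaryTwoArmDecay` (stmt-CriticalPhenomena-0911), refuter cdisprove seat

Crux (route PercLowPointHalfSpace, item A, rank 2):
  `∃ κ C, 0 < κ ∧ ∀ r ≥ 1, P_{p_c(ℤ³)}[arm_H(0,r) ∧ arm_H(e,r) ∧ 0 ↮_H e] ≤ C r^{-(5/2+κ)}`,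
  `H = {x₀ ≥ 0}`, `e = (0,1,0)`, bond percolation on the INDUCED half-space graph at `p_c(ℤ³)`.

## Findings (index; details in the docstrings below).  VERDICT SO FAR: no kill — genuine open exponent bound.

* READ-BACK: the formal statement is faithful (definitions unfolded: `bondPercolation = setBer(E,p)`,
  `zdGraph = hasse` of the product order = nearest-neighbour ℤ³, `openConnIn S x y` = reachability in the open
  graph induced on `S` (reflexive on `S`), `5/2 : ℝ`, `criticalProbI 3 = p_c`). No junk operator for `r ≥ 1`.
* (a) LOAD-BEARING ANALYSIS (all kernel-checked, axioms {propext, choice, Quot.sound}; LANDED in the tree as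
  `Theorems/BoundaryTwoArmDecay/Negative/OneArmLowerBound.lean` (p73288, accepted) and `…/Negative/LoadBearing.lean`
  (to follow) — import those rather than this work file):
  - `boundaryTwoArmDecay_false_without_r_ge_one` : dropping the guard `1 ≤ r` makes the crux FALSE
    (`Real.rpow` junk `0^{-(5/2+κ)} = 0` vs `P(E 0) = P(0 ↮_H e) ≥ (1-p_c)^6 > 0`). Formalisation boundary only.
  - `boundaryTwoArmDecayWithoutKappaPos_trivial` : dropping `0 < κ` makes it TRIVIAL (`κ = -5/2`, `C = 1`).
  - `boundaryTwoArmDecay_false_without_disjoint` : dropping `0 ↮_H e` makes it FALSE: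
    `P(both arms) ≥ p_c · P(armBox (r+1)) ≥ p_c/(36(2r+3)²)` (Harris–FKG + the one-arm bound below), not
    `O(r^{-5/2-κ})`.  So every proof must use the disjointness quantitatively (repulsion), as intended.
  - `boundaryTwoArmDecay_false_without_second_arm` : dropping "C_H(e) ALSO reaches r" (keeping disjointness)
    makes it FALSE: `P(arm_H(0,r) ∧ 0 ↮_H e) ≥ (1-p_c)^6 p_c^8/(36(2r+1)²)` for r ≥ 2 (last-exit path lemma +
    insertion tolerance for an 8-edge detour around e + closing the star of e).  So BOTH arms AND the
    disjointness enter any proof; the exponent gain is a genuinely two-cluster boundary effect.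
  - The WALL is load-bearing (numerics): the same event in the bulk has exponent d − 1/ν ≈ 1.86 < 5/2
    (red-bond scaling; MC mode `bulk` of my kit job).  Hence no boundary-insensitive argument (BK/Reimer,
    Cerf 2015 / van den Berg–van Engelenburg bulk two-arm counting transplanted verbatim) can reach 5/2+κ.
* (b) TIGHTNESS / NEIGHBOURING FACTS:
  - `halfSpaceArm_ge` : **rigorous polynomial LOWER bound on the boundary one-arm at p_c(ℤ³)**,
    `P_{p_c}(C_H(0) reaches sup-distance n) ≥ 1/(36(2n+1)²)`, from `φ_{p_c}(Λ_n) ≥ 1`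
    (Duminil-Copin–Tassion sharpness, in tree) + signed-permutation symmetry + translation.
  - `quantitativeBGN_exponent_le_two` : hence any exponent `a` in item C (`QuantitativeBGN`) has `a ≤ 2`
    (numerically a = x_s ≈ 0.975, Deng–Blöte 2005).  BK then caps what A can inherit from C at `2a ≤ 4`… but
    BK's true value 2x_s ≈ 1.95 < 5/2 is the real obstacle: the gain must come from repulsion at the wall.
  - Predicted value a₂ = d = 3 exactly (Cardy 1996, Scaling and Renormalization, §7.3 p.125 L7 and footnote p.126:
    'the leading even boundary operator [at the ordinary transition] is the stress tensor, which always has scaling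
    dimension d'; energy–energy correlations along the wall ~ r^{-2d}; boundary-CFT lore: the two-distinct-clusters-at-adjacent-boundary-sites
    operator is the boundary energy operator ~ displacement operator T_⊥⊥|_∂H, protected dimension d; 2D check:
    half-plane 3-arm exponent 2 = d, Smirnov–Werner 2001).  So the margin of the item is κ < 1/2, and the
    natural strengthening "exponent > 3" is predicted FALSE.
* (c) NUMERICS (kill criterion (i) of the route; my death-certified lockstep estimator mc/main.py, validated against
  naive exploration; evidence files attached to the item):
  - HALF-SPACE (the crux event, verbatim): 1.82·10⁷ samples, RMAX 128 (local run) — local slopes a₂(r→2r):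
    2.67 (4–8), 2.81 (6–12), 2.88 (8–16), 2.94 (12–24), 2.99±0.04 (16–32), 3.00±0.08 (24–48), 3.15±0.13 (32–64);
    window fits 2.71 [4,16], 2.89 [8,32], 2.99 [16,64]; cap bias ≤ 7·10⁻⁷ (affects only r ≥ 64, downward ≤ 0.15).
    P(E_r) = 2.12e-2 (4), 3.33e-3 (8), 4.54e-4 (16), 5.7e-5 (32), 6.4e-6 (64).  gen-1 reviewer: 2.74/3.04/3.09.
    ⇒ a₂ = 3.0 ± 0.1, i.e. the predicted a₂ = d; threshold 5/2 cleared with margin ≈ 0.5.  NO KILL.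
  - BULK control (same event with H replaced by ℤ³): 1.4·10⁶ samples, RMAX 64 — slopes 1.75 (4–8), 1.83 (6–12),
    1.88 (8–16), 1.98 (12–24) [cap-contaminated beyond]; consistent with d − 1/ν ≈ 1.86 and far BELOW 5/2:
    the wall is load-bearing.
  - ROOT VARIANTS (is floor-adjacency special?): roots 0,(1,0,0) [vertical pair]: slopes 2.88 (8–16), 2.97 (12–24),
    3.00±0.06 (16–32); roots 0,(0,2,0) [gap 2]: 2.81, 2.92, 3.03±0.06 (7.7·10⁶ / 4.2·10⁶ samples, RMAX 96).
    ⇒ a₂ = 3 for any O(1)-separated pair of roots at the wall: the exponent is that of the boundary 'energy'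
    operator, not an artefact of the particular pair (0, e).
  - ONE-ARM calibration (kit j007985, 6.1·10⁵ samples, RMAX 128): a₁ = 0.956 (16–32), 0.959±0.012 (32–64),
    0.950±0.017 (64–128) ≈ x_s; conditional in-box mass exponent m_eff = 2.42/2.48/2.49 → d_f ≈ 2.52 < 11/4
    (items C and B numerically healthy; notes attached to 0912/0913).
  - kit half-space jobs j015888–890 (RMAX 256, 0.5 h cap each) resubmitted after the first batch was cancelled
    owner-dead; their summary.json auto-attaches to the item and refines the 64–128 / 128–256 slopes.
* (d) Targets: none yet (`stuck_stubs = []`).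
* (e) Near-misses: none — a refutation needs a₂ ≤ 5/2, contradicted by all numerics; no cheap route to ¬A.
-/

namespace Summit.CriticalPhenomena.PercolationContinuityZ3.Cruxes.BoundaryTwoArmDecay.Disproof

open MeasureTheory ProbabilityTheory Filter Topology
open Literature.Probability.Percolation Literature.Probability.LatticeModels
open Literature.Probability.Percolation.DCT16
open Summit.CriticalPhenomena.PercolationContinuityZ3.Theses.PercLowPointHalfSpace

noncomputable section


/-- The half-space `H = {x₀ ≥ 0}`. -/
abbrev H : Set (Site 3) := {x : Site 3 | 0 ≤ x 0}

/-- The floor neighbour `e = (0,1,0)` of the origin. -/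
abbrev e : Site 3 := Pi.single 1 1

/-- The critical bond measure on `ℤ³`. -/
abbrev μ : Measure (BondConfig (Site 3)) := bondPercolation (zdGraph 3) (criticalProbI 3)

/-- The crux event at scale `r`: both half-space clusters of `0` and `e` reach sup-distance `r`
and are disjoint (verbatim the set-builder of the route decl). -/
def E (r : ℕ) : Set (BondConfig (Site 3)) :=
  {ω | (∃ y : Site 3, (∃ i : Fin 3, (r : ℤ) ≤ |y i|) ∧ ω ∈ openConnIn H 0 y) ∧
    (∃ y : Site 3, (∃ i : Fin 3, (r : ℤ) ≤ |y i - e i|) ∧ ω ∈ openConnIn H e y) ∧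
    ω ∉ openConnIn H 0 e}

/-- The route decl, restated through `E` (definitional). -/
theorem boundaryTwoArmDecay_iff :
    BoundaryTwoArmDecay ↔ ∃ κ C : ℝ, 0 < κ ∧ ∀ r : ℕ, 1 ≤ r → μ.real (E r) ≤ C * (r : ℝ) ^ (-(5 / 2 + κ)) :=
  Iff.rfl

/-! ## (a) Load-bearing analysis -/

/-- The crux with the guard `1 ≤ r` DROPPED. -/
def BoundaryTwoArmDecayWithoutRGeOne : Prop :=
  ∃ κ C : ℝ, 0 < κ ∧ ∀ r : ℕ, μ.real (E r) ≤ C * (r : ℝ) ^ (-(5 / 2 + κ))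

/-- The crux with the positivity `0 < κ` DROPPED. -/
def BoundaryTwoArmDecayWithoutKappaPos : Prop :=
  ∃ κ C : ℝ, ∀ r : ℕ, 1 ≤ r → μ.real (E r) ≤ C * (r : ℝ) ^ (-(5 / 2 + κ))

/-- The six edges of `ℤ³` at the origin. -/
def starEdges : Finset (Sym2 (Site 3)) :=
  Finset.univ.image (fun i : Fin 3 => s((0 : Site 3), Pi.single i 1)) ∪
    Finset.univ.image (fun i : Fin 3 => s((0 : Site 3), -Pi.single i 1))

/-- If all six edges at the origin are closed and `ω` only uses lattice edges, then `0` is joined to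
nothing inside `H`: in particular `ω ∉ openConnIn H 0 e`. -/
theorem not_openConnIn_of_star_closed {ω : BondConfig (Site 3)} (hω : ω ⊆ (zdGraph 3).edgeSet)
    (hc : ∀ f ∈ starEdges, f ∉ ω) {y : Site 3} (hy : y ≠ 0) : ω ∉ openConnIn H 0 y := by
  rintro ⟨h0, hyH, hreach⟩
  -- generalise the endpoints and induct on a walk
  suffices key : ∀ (a b : H), ((openGraph ω).induce H).Reachable a b → a.1 = 0 → b.1 = 0 by
    exact hy (key ⟨0, h0⟩ ⟨y, hyH⟩ hreach rfl)
  intro a b hab ha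
  obtain ⟨p⟩ := hab
  induction p with
  | nil => exact ha
  | @cons u v w hadj q ih =>
    exfalso
    have hadj' : (openGraph ω).Adj u.1 v.1 := hadj
    rw [openGraph_adj] at hadj'
    obtain ⟨hmem, hne⟩ := hadj'
    rw [ha] at hmem hne
    have hedge : (zdGraph 3).Adj 0 v.1 := by
      simpa [SimpleGraph.mem_edgeSet] using hω hmem
    obtain ⟨i, hv | hv⟩ := (zdGraph_adj_iff 0 v.1).1 hedge
    · apply hc _ _ hmem
      rw [hv, zero_add]
      exact Finset.mem_union.2 (Or.inl (Finset.mem_image_of_mem _ (Finset.mem_univ i)))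
    · apply hc _ _ hmem
      have : v.1 = -Pi.single i 1 := eq_neg_of_add_eq_zero_left hv.symm
      rw [this]
      exact Finset.mem_union.2 (Or.inr (Finset.mem_image_of_mem _ (Finset.mem_univ i)))

/-- `{all six edges at 0 closed} ∩ {ω ⊆ E(ℤ³)} ⊆ E 0`. -/
theorem star_closed_subset_E_zero :
    {ω : BondConfig (Site 3) | ∀ f ∈ starEdges, f ∉ ω} ∩ {ω | ω ⊆ (zdGraph 3).edgeSet} ⊆ E 0 := by
  rintro ω ⟨hc, hω⟩
  have h0 : (0 : Site 3) ∈ H := by simp [H]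
  have he : e ∈ H := by simp [H, e]
  refine ⟨⟨0, ⟨0, by simp⟩, h0, h0, SimpleGraph.Reachable.refl _⟩,
    ⟨e, ⟨0, by simp [e]⟩, he, he, SimpleGraph.Reachable.refl _⟩, ?_⟩
  have hne : e ≠ 0 := by
    intro h
    have := congr_fun h 1
    simp [e] at this
  exact not_openConnIn_of_star_closed hω hc hne

/-- `P_{p_c}(E 0) > 0`: with probability at least `(1 - p_c)^6 > 0` the six edges at the origin are closed
(`p_c(ℤ³) < 1`, Grimmett 1999 §1.4, in tree), and then `E 0` holds. -/
theorem measureReal_E_zero_pos : 0 < μ.real (E 0) := by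
  have hpc : ((criticalProbI 3 : unitInterval) : ℝ) < 1 := by
    rw [coe_criticalProbI]
    exact (Grimmett1999_criticalProb_pos_lt_one_holds 3 (by norm_num)).2
  have h1 : (1 - ((criticalProbI 3 : unitInterval) : ℝ)) ^ starEdges.card ≤
      μ.real {ω | ∀ f ∈ starEdges, f ∉ ω} :=
    le_bondPercolation_real_forall_notMem (zdGraph 3) (criticalProbI 3) starEdges
  have h2 : 0 < (1 - ((criticalProbI 3 : unitInterval) : ℝ)) ^ starEdges.card :=
    pow_pos (sub_pos.2 hpc) _
  have hA : {ω : BondConfig (Site 3) | ω ⊆ (zdGraph 3).edgeSet} =ᵐ[μ] Set.univ :=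
    Filter.eventuallyEq_univ.2 setBernoulli_ae_subset
  have h3 : μ.real ({ω : BondConfig (Site 3) | ∀ f ∈ starEdges, f ∉ ω} ∩ {ω | ω ⊆ (zdGraph 3).edgeSet})
      = μ.real {ω : BondConfig (Site 3) | ∀ f ∈ starEdges, f ∉ ω} :=
    measureReal_congr (inter_ae_eq_left_of_ae_eq_univ hA)
  have h4 : μ.real ({ω : BondConfig (Site 3) | ∀ f ∈ starEdges, f ∉ ω} ∩ {ω | ω ⊆ (zdGraph 3).edgeSet})
      ≤ μ.real (E 0) := measureReal_mono star_closed_subset_E_zero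
  linarith

/-- **The guard `1 ≤ r` is load-bearing** (formalisation boundary): without it the crux is FALSE, because
at `r = 0` Mathlib's `Real.rpow` gives `(0:ℝ)^(-(5/2+κ)) = 0` while `P(E 0) = P(0 ↮_H e) > 0`.
Any proof of A must therefore use `1 ≤ r` (if only to keep the right-hand side positive). -/
theorem boundaryTwoArmDecay_false_without_r_ge_one : ¬ BoundaryTwoArmDecayWithoutRGeOne := by
  rintro ⟨κ, C, hκ, h⟩
  have h0 := h 0
  rw [Nat.cast_zero, Real.zero_rpow (by linarith), mul_zero] at h0
  exact absurd h0 (not_le.2 measureReal_E_zero_pos)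

/-- **`0 < κ` is load-bearing** in the opposite direction: without it the crux is TRIVIAL
(`κ = -5/2`, `C = 1`, since probabilities are at most `1`). -/
theorem boundaryTwoArmDecayWithoutKappaPos_trivial : BoundaryTwoArmDecayWithoutKappaPos := by
  refine ⟨-(5 / 2), 1, fun r _ => ?_⟩
  have : (-(5 / 2 + -(5 / 2 : ℝ))) = 0 := by norm_num
  rw [this, Real.rpow_zero, mul_one]
  exact measureReal_le_one

/-! ## (b) Monotonicity in `r` (information for provers: dyadic scales suffice) -/

/-- `E` is decreasing in `r`. -/
theorem E_antitone : Antitone E := by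
  intro r s hrs ω hω
  obtain ⟨⟨y, ⟨i, hi⟩, hy⟩, ⟨y', ⟨i', hi'⟩, hy'⟩, hne⟩ := hω
  exact ⟨⟨y, ⟨i, le_trans (by exact_mod_cast hrs) hi⟩, hy⟩, ⟨y', ⟨i', le_trans (by exact_mod_cast hrs) hi'⟩, hy'⟩, hne⟩

/-! # Part 2: the one-arm lower bound, tightness for C, and ¬(crux without disjointness) -/



/-! ## The Hammersley / Duminil-Copin–Tassion input at `p_c(ℤ³)` -/

/-- `q ↦ φ_q(S)` (parameter clamped to `[0,1]`) is continuous: a finite sum of cylinder polynomials. -/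
theorem continuous_phi (S : Finset (Site 3)) :
    Continuous (fun q : ℝ => DCT16.phi (Set.projIcc (0 : ℝ) 1 zero_le_one q) S) := by
  classical
  simp only [DCT16.phi_def]
  refine (continuous_subtype_val.comp continuous_projIcc).mul ?_
  refine continuous_finsetSum _ fun x _ => continuous_finsetSum _ fun y _ => ?_
  have h : (fun q : ℝ => (bondPercolation (zdGraph 3) (Set.projIcc 0 1 zero_le_one q)).real
      (openConnIn (↑S : Set (Site 3)) 0 x)) = fun q => Russo.cylPoly (zdGraph 3).edgeSet S.sym2
        (openConnIn (↑S : Set (Site 3)) 0 x) (Set.projIcc 0 1 zero_le_one q) := by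
    funext q
    rw [bondPercolation]
    exact Russo.measureReal_eq_cylPoly
      (determinedBy_openConnIn (↑S : Set (Site 3)) 0 x (K := ↑S.sym2) (by rw [Finset.coe_sym2])) _ _
  rw [h]
  exact (continuous_iff_continuousAt.2 fun q => (Russo.hasDerivAt_cylPoly _ _ _ q).continuousAt).comp
    (continuous_subtype_val.comp continuous_projIcc)

/-- **`φ_{p_c}(S) ≥ 1` for every finite `S ∋ 0`** (bond percolation on `ℤ³`): otherwise, by continuity,
`φ_q(S) < 1` for some `q ∈ (p_c, 1)`, so `q ≤ p̃_c = p_c` (Duminil-Copin–Tassion 2016, Thm 1.1, in tree),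
absurd. Uses `p_c(ℤ³) < 1` (Grimmett 1999 §1.4, in tree). -/
theorem one_le_phi_criticalProb {S : Finset (Site 3)} (h0S : (0 : Site 3) ∈ S) :
    1 ≤ DCT16.phi (criticalProbI 3) S := by
  by_contra hlt
  rw [not_le] at hlt
  set pc : ℝ := criticalProb (zdGraph 3) (0 : Site 3) with hpc
  have hpc1 : pc < 1 := (Grimmett1999_criticalProb_pos_lt_one_holds 3 (by norm_num)).2
  have hpc0 : 0 ≤ pc := (criticalProb_mem_Icc (zdGraph 3) (0 : Site 3)).1
  have hproj : Set.projIcc (0 : ℝ) 1 zero_le_one pc = criticalProbI 3 := by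
    rw [Set.projIcc_of_mem _ ⟨hpc0, hpc1.le⟩]; rfl
  have hcont : ContinuousAt (fun q : ℝ => DCT16.phi (Set.projIcc (0 : ℝ) 1 zero_le_one q) S) pc :=
    (continuous_phi S).continuousAt
  have hlt' : (fun q : ℝ => DCT16.phi (Set.projIcc (0 : ℝ) 1 zero_le_one q) S) pc < 1 := by
    simp only [hproj]; exact hlt
  have hev : ∀ᶠ q in 𝓝 pc, DCT16.phi (Set.projIcc (0 : ℝ) 1 zero_le_one q) S < 1 :=
    hcont.preimage_mem_nhds (Iio_mem_nhds hlt')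
  obtain ⟨δ, hδ, hball⟩ := Metric.eventually_nhds_iff.1 hev
  set q : ℝ := pc + min (δ / 2) ((1 - pc) / 2) with hq
  have hmin_pos : 0 < min (δ / 2) ((1 - pc) / 2) := lt_min (by linarith) (by linarith)
  have hq_gt : pc < q := by rw [hq]; linarith
  have hq_lt1 : q < 1 := by
    have := min_le_right (δ / 2) ((1 - pc) / 2); rw [hq]; linarith
  have hq_dist : dist q pc < δ := by
    have := min_le_left (δ / 2) ((1 - pc) / 2)
    rw [Real.dist_eq, abs_of_pos (by linarith)]; rw [hq]; linarith
  have hq01 : q ∈ unitInterval := ⟨by linarith, hq_lt1.le⟩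
  have hφq := hball hq_dist
  rw [Set.projIcc_of_mem _ hq01] at hφq
  have h1 : q ≤ DCT16.tildeCriticalProb 3 :=
    le_csSup (DCT16.bddAbove_tildeSet 3) ⟨hq01, S, h0S, hφq⟩
  have h2 : DCT16.tildeCriticalProb 3 ≤ pc := tildeCriticalProb_le_criticalProb 3
  linarith

/-! ## Geometry: the finite-volume boundary arm event -/

/-- Sites at sup-distance `≥ n` from the origin. -/
def far (n : ℕ) : Set (Site 3) := {y | ∃ i : Fin 3, (n : ℤ) ≤ |y i|}

/-- The half-box `{0 ≤ w₀} ∩ Λ_{2n}`. -/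
def halfBox (n : ℕ) : Finset (Site 3) := (box 3 (2 * n)).filter fun w => 0 ≤ w 0

/-- The finite-volume boundary one-arm event: `0` is joined inside the half-box `H ∩ Λ_{2n}` to a site at
sup-distance `≥ n`. -/
def armBox (n : ℕ) : Set (BondConfig (Site 3)) := openCrossing (↑(halfBox n)) {0} (far n)

theorem halfBox_subset_H (n : ℕ) : (↑(halfBox n) : Set (Site 3)) ⊆ H := by
  intro w hw
  rw [Finset.mem_coe, halfBox, Finset.mem_filter] at hw
  exact hw.2

private theorem openConnIn_mono' {V : Type*} {S S' : Set V} (h : S ⊆ S') (x y : V) :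
    (openConnIn S x y : Set (BondConfig V)) ⊆ openConnIn S' x y := by
  rintro ω ⟨hx, hy, hr⟩
  exact ⟨h hx, h hy, hr.map (SimpleGraph.induceHomOfLE (G := openGraph ω) h).toHom⟩

private theorem openConnIn_comm' {V : Type*} (S : Set V) (x y : V) :
    (openConnIn S x y : Set (BondConfig V)) = openConnIn S y x := by
  ext ω
  constructor <;> rintro ⟨hx, hy, h⟩ <;> exact ⟨hy, hx, h.symm⟩

private theorem openCrossing_singleton' {V : Type*} (S : Set V) (x y : V) :
    openCrossing S {x} {y} = openConnIn S x y := by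
  ext ω; simp [openCrossing]

/-- The finite-volume arm lies inside the crux's (infinite half-space) one-arm event. -/
theorem armBox_subset_halfSpaceArm (n : ℕ) :
    armBox n ⊆ {ω | ∃ y : Site 3, (∃ i : Fin 3, (n : ℤ) ≤ |y i|) ∧ ω ∈ openConnIn H 0 y} := by
  rintro ω ⟨a, ha, b, hb, hω⟩
  rw [Set.mem_singleton_iff] at ha
  subst ha
  exact ⟨b, hb, openConnIn_mono' (halfBox_subset_H n) _ _ hω⟩

/-- `armBox n` is measurable (a countable union of local events). -/
theorem measurableSet_armBox (n : ℕ) : MeasurableSet (armBox n) := by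
  have h : armBox n = ⋃ y ∈ far n, openConnIn (↑(halfBox n) : Set (Site 3)) 0 y := by
    ext ω; simp [armBox, openCrossing]
  rw [h]
  exact MeasurableSet.biUnion (Set.to_countable _) fun y _ => measurableSet_openConnIn (halfBox n) 0 y

/-- **Symmetry + translation step.** For a site `x` of the inner boundary of `Λ_n`,
`P(0 ↔ x in Λ_n) ≤ P(armBox n)`: rotate `x` onto the bottom face (`signedPerm`, preserves `Λ_n`, `0` and
`P_{p_c}`), then translate `x ↦ 0`; the box goes into the half-box `H ∩ Λ_{2n}` and `0` goes to a site at
sup-distance `n`. -/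
theorem real_openConnIn_box_le_armBox {n : ℕ} {x : Site 3}
    (hx : x ∈ innerBoundary (zdGraph 3) (box 3 n)) :
    μ.real (openConnIn (↑(box 3 n) : Set (Site 3)) 0 x) ≤ μ.real (armBox n) := by
  obtain ⟨i, hi⟩ := exists_eq_of_mem_innerBoundary_box hx
  have hxbox : x ∈ box 3 n := (mem_innerBoundary_iff.1 hx).1
  obtain ⟨s, hs⟩ : ∃ s : ℤˣ, (s : ℤ) * x i = -n := by
    rcases hi with h | h
    · exact ⟨-1, by rw [h]; simp⟩
    · exact ⟨1, by rw [h]; simp⟩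
  set ψ : zdGraph 3 ≃g zdGraph 3 := zdSignedPermIso (Equiv.swap i 0) (fun _ => s) with hψ
  have hψ0 : ψ 0 = 0 := Site.signedPerm_zero _ _
  have hψx0 : (ψ x) 0 = -n := by
    show (Site.signedPerm (Equiv.swap i 0) (fun _ => s) x) 0 = -n
    rw [Site.signedPerm_apply, Equiv.symm_swap, Equiv.swap_apply_right]; exact hs
  have hψbox : ψ '' (↑(box 3 n) : Set (Site 3)) = ↑(box 3 n) := signedPerm_image_box _ _ n
  have hψxbox : ψ x ∈ box 3 n := (signedPerm_mem_box_iff _ _).2 hxbox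
  -- step 1: symmetry
  have h1 : μ.real (openConnIn (↑(box 3 n) : Set (Site 3)) 0 x) =
      μ.real (openConnIn (↑(box 3 n) : Set (Site 3)) 0 (ψ x)) := by
    have := bondPercolation_real_image ψ (criticalProbI 3) (↑(box 3 n) : Set (Site 3)) {0} {x}
    rw [Set.image_singleton, Set.image_singleton, hψbox, hψ0, openCrossing_singleton',
      openCrossing_singleton'] at this
    exact this.symm
  -- step 2: inclusion into the translated arm event
  set x' : Site 3 := ψ x with hx'
  have hx'box : ∀ j, -(n : ℤ) ≤ x' j ∧ x' j ≤ n := mem_box.1 hψxbox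
  have h2 : (openConnIn (↑(box 3 n) : Set (Site 3)) 0 x' : Set (BondConfig (Site 3))) ⊆
      openCrossing ((· + x') '' (↑(halfBox n) : Set (Site 3))) ((· + x') '' {0}) ((· + x') '' far n) := by
    intro ω hω
    refine ⟨x', ⟨0, rfl, zero_add x'⟩, 0, ⟨-x', ⟨0, ?_⟩, neg_add_cancel x'⟩, ?_⟩
    · simp [hψx0]
    · rw [openConnIn_comm'] at hω
      refine openConnIn_mono' ?_ _ _ hω
      intro w hw
      refine ⟨w - x', ?_, sub_add_cancel w x'⟩
      rw [Finset.mem_coe] at hw ⊢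
      rw [halfBox, Finset.mem_filter, mem_box]
      have hwb := mem_box.1 hw
      refine ⟨fun j => ?_, ?_⟩
      · have := hwb j; have := hx'box j
        simp only [Pi.sub_apply, Nat.cast_mul, Nat.cast_ofNat]
        omega
      · simp only [Pi.sub_apply, hψx0]
        have := hwb 0
        omega
  have h3 := real_openCrossing_shift (criticalProbI 3) x' (↑(halfBox n) : Set (Site 3)) {0} (far n)
  calc μ.real (openConnIn (↑(box 3 n) : Set (Site 3)) 0 x)
      = μ.real (openConnIn (↑(box 3 n) : Set (Site 3)) 0 x') := h1
    _ ≤ μ.real (openCrossing ((· + x') '' (↑(halfBox n) : Set (Site 3))) ((· + x') '' {0})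
          ((· + x') '' far n)) := measureReal_mono h2
    _ = μ.real (armBox n) := h3

/-- Counting: `Σ_{x ∈ Λ_n} #{y ∼ x : y ∉ Λ_n} ≤ 6 |∂ⁱⁿΛ_n| ≤ 36 (2n+1)²`. -/
theorem sum_card_outer_le (n : ℕ) :
    ∑ x ∈ box 3 n, (((zdGraph 3).neighborFinset x).filter (fun y => y ∉ box 3 n)).card ≤
      36 * (2 * n + 1) ^ 2 := by
  classical
  have hterm : ∀ x ∈ box 3 n, (((zdGraph 3).neighborFinset x).filter (fun y => y ∉ box 3 n)).card ≤
      if x ∈ innerBoundary (zdGraph 3) (box 3 n) then 6 else 0 := by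
    intro x hx
    split_ifs with hb
    · calc (((zdGraph 3).neighborFinset x).filter (fun y => y ∉ box 3 n)).card
          ≤ ((zdGraph 3).neighborFinset x).card := Finset.card_filter_le _ _
        _ = 2 * 3 := card_neighborFinset_zdGraph_holds x
        _ = 6 := by norm_num
    · rw [Nat.le_zero, Finset.card_eq_zero, Finset.filter_eq_empty_iff]
      intro y hy hyn
      exact hb (mem_innerBoundary_iff.2 ⟨hx, y, hyn, (SimpleGraph.mem_neighborFinset _ _ _).1 hy⟩)
  calc ∑ x ∈ box 3 n, (((zdGraph 3).neighborFinset x).filter (fun y => y ∉ box 3 n)).card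
      ≤ ∑ x ∈ box 3 n, (if x ∈ innerBoundary (zdGraph 3) (box 3 n) then 6 else 0) :=
        Finset.sum_le_sum hterm
    _ = ∑ x ∈ (box 3 n).filter (fun x => x ∈ innerBoundary (zdGraph 3) (box 3 n)), 6 := by
        rw [Finset.sum_filter]
    _ = 6 * ((box 3 n).filter (fun x => x ∈ innerBoundary (zdGraph 3) (box 3 n))).card := by
        rw [Finset.sum_const, smul_eq_mul, mul_comm]
    _ ≤ 6 * (innerBoundary (zdGraph 3) (box 3 n)).card := by
        gcongr
        exact fun x hx => (Finset.mem_filter.1 hx).2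
    _ ≤ 6 * (2 * 3 * (2 * n + 1) ^ (3 - 1)) := by
        gcongr
        exact card_innerBoundary_box_le n
    _ = 36 * (2 * n + 1) ^ 2 := by norm_num; ring

/-- **A rigorous polynomial LOWER bound on the boundary one-arm at `p_c(ℤ³)`**:
`P_{p_c}(armBox n) ≥ 1 / (36 (2n+1)²)`. Proof: `1 ≤ φ_{p_c}(Λ_n) = p_c Σ_{x} Σ_{y ∼ x, y ∉ Λ_n} P(0 ↔ x in Λ_n)`
(Duminil-Copin–Tassion), every term is `≤ P(armBox n)` by symmetry + translation
(`real_openConnIn_box_le_armBox`), and there are at most `36 (2n+1)²` terms. -/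
theorem armBox_ge (n : ℕ) : 1 / (36 * (2 * (n : ℝ) + 1) ^ 2) ≤ μ.real (armBox n) := by
  classical
  have hφ := one_le_phi_criticalProb (S := box 3 n) (zero_mem_box 3 n)
  rw [DCT16.phi_def] at hφ
  set P : ℝ := μ.real (armBox n) with hP
  set T : ℝ := ∑ x ∈ box 3 n, ∑ y ∈ (zdGraph 3).neighborFinset x with y ∉ box 3 n,
    (bondPercolation (zdGraph 3) (criticalProbI 3)).real (openConnIn (↑(box 3 n) : Set (Site 3)) 0 x)
    with hT
  have hpc1 : ((criticalProbI 3 : unitInterval) : ℝ) ≤ 1 := (criticalProbI 3).2.2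
  have hT0 : 0 ≤ T :=
    Finset.sum_nonneg fun _ _ => Finset.sum_nonneg fun _ _ => measureReal_nonneg
  have hsum_le : T ≤ ∑ x ∈ box 3 n, ∑ y ∈ (zdGraph 3).neighborFinset x with y ∉ box 3 n, P := by
    refine Finset.sum_le_sum fun x hx => Finset.sum_le_sum fun y hy => ?_
    rw [Finset.mem_filter] at hy
    exact real_openConnIn_box_le_armBox
      (mem_innerBoundary_iff.2 ⟨hx, y, hy.2, (SimpleGraph.mem_neighborFinset _ _ _).1 hy.1⟩)
  have hcount : (∑ x ∈ box 3 n, ∑ y ∈ (zdGraph 3).neighborFinset x with y ∉ box 3 n, P) ≤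
      36 * (2 * (n : ℝ) + 1) ^ 2 * P := by
    simp only [Finset.sum_const, nsmul_eq_mul]
    rw [← Finset.sum_mul]
    refine mul_le_mul_of_nonneg_right ?_ measureReal_nonneg
    have := sum_card_outer_le n
    exact_mod_cast this
  have key : (1 : ℝ) ≤ 36 * (2 * (n : ℝ) + 1) ^ 2 * P :=
    calc (1 : ℝ) ≤ (criticalProbI 3 : ℝ) * T := hφ
      _ ≤ 1 * T := mul_le_mul_of_nonneg_right hpc1 hT0
      _ = T := one_mul T
      _ ≤ _ := hsum_le
      _ ≤ _ := hcount
  rw [div_le_iff₀ (by positivity)]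
  linarith

/-- The same bound for the crux's infinite-volume one-arm event (the set of `QuantitativeBGN`, item C):
`P_{p_c}(C_H(0) reaches sup-distance ≥ n) ≥ 1/(36(2n+1)²)`. -/
theorem halfSpaceArm_ge (n : ℕ) :
    1 / (36 * (2 * (n : ℝ) + 1) ^ 2) ≤
      μ.real {ω | ∃ y : Site 3, (∃ i : Fin 3, (n : ℤ) ≤ |y i|) ∧ ω ∈ openConnIn H 0 y} :=
  (armBox_ge n).trans (measureReal_mono (armBox_subset_halfSpaceArm n))

/-- Large powers: for `b > 0` and any `M` there is `r ≥ 1` with `M < r^b`. -/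
theorem exists_nat_rpow_gt {b : ℝ} (hb : 0 < b) (M : ℝ) : ∃ r : ℕ, 1 ≤ r ∧ M < (r : ℝ) ^ b := by
  have h1 : ∀ᶠ r : ℕ in atTop, M < (r : ℝ) ^ b :=
    ((tendsto_rpow_atTop hb).comp tendsto_natCast_atTop_atTop).eventually_gt_atTop M
  obtain ⟨r, hr1, hr2⟩ := ((eventually_ge_atTop 1).and h1).exists
  exact ⟨r, hr1, hr2⟩

/-- **TIGHTNESS for item C (`QuantitativeBGN`)**: any admissible exponent satisfies `a ≤ 2`.
(Numerically `a = x_s ≈ 0.975`; the rigorous window for the boundary one-arm exponent at `p_c(ℤ³)` is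
thus `(0, 2]` — the lower end `a > 0` being exactly crux C.) -/
theorem quantitativeBGN_exponent_le_two {a C : ℝ}
    (h : ∀ r : ℕ, 1 ≤ r → μ.real {ω | ∃ y : Site 3, (∃ i : Fin 3, (r : ℤ) ≤ |y i|) ∧
      ω ∈ openConnIn H 0 y} ≤ C * (r : ℝ) ^ (-a)) : a ≤ 2 := by
  by_contra ha
  rw [not_le] at ha
  -- for r ≥ 1: 1/(36 (2r+1)^2) ≤ C r^{-a}, and (2r+1)^2 ≤ 9 r^2, so r^{a-2} ≤ 324 C
  have hb : 0 < a - 2 := by linarith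
  obtain ⟨r, hr1, hr⟩ := exists_nat_rpow_gt hb (324 * |C| + 1)
  have hr0 : (0 : ℝ) < r := by exact_mod_cast hr1
  have hlow := (halfSpaceArm_ge r).trans (h r hr1)
  -- C r^{-a} ≤ |C| r^{-a}
  have hrpow_pos : 0 < (r : ℝ) ^ (-a) := Real.rpow_pos_of_pos hr0 _
  have hC : C * (r : ℝ) ^ (-a) ≤ |C| * (r : ℝ) ^ (-a) :=
    mul_le_mul_of_nonneg_right (le_abs_self C) hrpow_pos.le
  have h9 : (2 * (r : ℝ) + 1) ^ 2 ≤ 9 * (r : ℝ) ^ (2 : ℝ) := by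
    rw [Real.rpow_two]; have : (1 : ℝ) ≤ r := by exact_mod_cast hr1
    nlinarith
  -- 1 ≤ 36 (2r+1)^2 |C| r^{-a} ≤ 324 |C| r^2 r^{-a} = 324 |C| r^{-(a-2)}
  have h36 : (1 : ℝ) ≤ 36 * (2 * (r : ℝ) + 1) ^ 2 * (|C| * (r : ℝ) ^ (-a)) := by
    have := hlow.trans hC
    rwa [div_le_iff₀ (by positivity), mul_comm] at this
  have hsplit : (r : ℝ) ^ (2 : ℝ) * (r : ℝ) ^ (-a) = ((r : ℝ) ^ (a - 2))⁻¹ := by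
    rw [← Real.rpow_add hr0, ← Real.rpow_neg hr0.le]; congr 1; ring
  have hpow_pos : 0 < (r : ℝ) ^ (a - 2) := Real.rpow_pos_of_pos hr0 _
  have : (1 : ℝ) ≤ 324 * |C| * ((r : ℝ) ^ (a - 2))⁻¹ := by
    calc (1 : ℝ) ≤ 36 * (2 * (r : ℝ) + 1) ^ 2 * (|C| * (r : ℝ) ^ (-a)) := h36
      _ ≤ 36 * (9 * (r : ℝ) ^ (2 : ℝ)) * (|C| * (r : ℝ) ^ (-a)) := by gcongr
      _ = 324 * |C| * ((r : ℝ) ^ (2 : ℝ) * (r : ℝ) ^ (-a)) := by ring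
      _ = 324 * |C| * ((r : ℝ) ^ (a - 2))⁻¹ := by rw [hsplit]
  rw [← div_eq_mul_inv, le_div_iff₀ hpow_pos, one_mul] at this
  linarith [abs_nonneg C]

/-! ## ¬ (crux without the disjointness clause) -/

/-- The crux event with the disjointness clause `0 ↮_H e` DROPPED (both arms only). -/
def E' (r : ℕ) : Set (BondConfig (Site 3)) :=
  {ω | (∃ y : Site 3, (∃ i : Fin 3, (r : ℤ) ≤ |y i|) ∧ ω ∈ openConnIn H 0 y) ∧
    (∃ y : Site 3, (∃ i : Fin 3, (r : ℤ) ≤ |y i - e i|) ∧ ω ∈ openConnIn H e y)}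

/-- The crux with `ω ∉ openConnIn H 0 e` DROPPED. -/
def BoundaryTwoArmDecayWithoutDisjoint : Prop :=
  ∃ κ C : ℝ, 0 < κ ∧ ∀ r : ℕ, 1 ≤ r → μ.real (E' r) ≤ C * (r : ℝ) ^ (-(5 / 2 + κ))

theorem e_mem_H : e ∈ H := by simp [H, e]

theorem adj_zero_e : (zdGraph 3).Adj 0 e := by
  rw [zdGraph_adj_iff]; exact ⟨1, Or.inl (by simp [e])⟩

theorem e_ne_zero : e ≠ 0 := by
  intro h; have := congr_fun h 1; simp [e] at this

/-- `armBox (r+1) ∩ {edge 0e open} ⊆ E' r`: the arm from `0` serves both roots once the floor edge is open. -/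
theorem armBox_inter_subset_E' (r : ℕ) :
    armBox (r + 1) ∩ {ω | s((0 : Site 3), e) ∈ ω} ⊆ E' r := by
  rintro ω ⟨⟨a, ha, b, ⟨i, hi⟩, hω⟩, hoe⟩
  rw [Set.mem_singleton_iff] at ha
  subst ha
  have hωH : ω ∈ openConnIn H 0 b := openConnIn_mono' (halfBox_subset_H _) _ _ hω
  refine ⟨⟨b, ⟨i, by push_cast at hi; omega⟩, hωH⟩, ⟨b, ⟨i, ?_⟩, ?_⟩⟩
  · have h1 : |e i| ≤ 1 := by
      simp only [e]; rcases eq_or_ne i 1 with rfl | hi1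
      · simp
      · simp [Pi.single_eq_of_ne hi1]
    have h2 : |b i| - |e i| ≤ |b i - e i| := abs_sub_abs_le_abs_sub _ _
    push_cast at hi; omega
  · -- e → 0 (open floor edge) → b, inside H
    obtain ⟨h0, hb, hreach⟩ := hωH
    refine ⟨e_mem_H, hb, SimpleGraph.Reachable.trans ?_ hreach⟩
    refine SimpleGraph.Adj.reachable ?_
    show (openGraph ω).Adj e 0
    rw [openGraph_adj]
    exact ⟨by rw [Sym2.eq_swap]; exact hoe, e_ne_zero⟩

/-- **Disjointness is load-bearing**: without `0 ↮_H e` the crux is FALSE. Indeed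
`P(E' r) ≥ p_c · P(armBox (r+1)) ≥ p_c / (36 (2r+3)²)` (Harris–FKG for the increasing events `armBox` and
`{0e open}`, then `armBox_ge`), which is not `O(r^{-5/2-κ})`. The true exponent of `E'` is the boundary
one-arm exponent `x_s ≈ 0.975` (Deng–Blöte 2005); rigorously it is `≤ 2` (`quantitativeBGN_exponent_le_two`). -/
theorem boundaryTwoArmDecay_false_without_disjoint : ¬ BoundaryTwoArmDecayWithoutDisjoint := by
  rintro ⟨κ, C, hκ, h⟩
  have hpc0 : 0 < ((criticalProbI 3 : unitInterval) : ℝ) :=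
    (Grimmett1999_criticalProb_pos_lt_one_holds 3 (by norm_num)).1
  set p : ℝ := ((criticalProbI 3 : unitInterval) : ℝ) with hp
  -- lower bound on P(E' r)
  have hlow : ∀ r : ℕ, p / (36 * (2 * ((r : ℝ) + 1) + 1) ^ 2) ≤ μ.real (E' r) := by
    intro r
    have hedge : s((0 : Site 3), e) ∈ (zdGraph 3).edgeSet := (SimpleGraph.mem_edgeSet _).2 adj_zero_e
    have hO : μ.real {ω : BondConfig (Site 3) | s((0 : Site 3), e) ∈ ω} = p :=
      bondPercolation_cylinder (zdGraph 3) (criticalProbI 3) hedge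
    have hBup : IsUpperSet ({ω | s((0 : Site 3), e) ∈ ω} : Set (BondConfig (Site 3))) :=
      fun ω ω' hle hω => hle hω
    have hfkg := harris_fkg_holds (zdGraph 3) (criticalProbI 3) (isUpperSet_openCrossing _ _ _)
      hBup (measurableSet_armBox (r + 1)) (measurableSet_mem _)
    have harm := armBox_ge (r + 1)
    calc p / (36 * (2 * ((r : ℝ) + 1) + 1) ^ 2) = 1 / (36 * (2 * ((r + 1 : ℕ) : ℝ) + 1) ^ 2) * p := by
          push_cast; ring
      _ ≤ μ.real (armBox (r + 1)) * μ.real {ω : BondConfig (Site 3) | s((0 : Site 3), e) ∈ ω} := by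
          rw [hO]; exact mul_le_mul_of_nonneg_right harm hpc0.le
      _ ≤ μ.real (armBox (r + 1) ∩ {ω | s((0 : Site 3), e) ∈ ω}) := hfkg
      _ ≤ μ.real (E' r) := measureReal_mono (armBox_inter_subset_E' r)
  -- pick r with r^{1/2+κ} > 900 |C| / p
  have hb : 0 < 1 / 2 + κ := by linarith
  obtain ⟨r, hr1, hr⟩ := exists_nat_rpow_gt hb (900 * |C| / p)
  have hr0 : (0 : ℝ) < r := by exact_mod_cast hr1
  have hr1' : (1 : ℝ) ≤ r := by exact_mod_cast hr1
  have hup := (hlow r).trans (h r hr1)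
  have hrpow_pos : 0 < (r : ℝ) ^ (-(5 / 2 + κ)) := Real.rpow_pos_of_pos hr0 _
  have hC : C * (r : ℝ) ^ (-(5 / 2 + κ)) ≤ |C| * (r : ℝ) ^ (-(5 / 2 + κ)) :=
    mul_le_mul_of_nonneg_right (le_abs_self C) hrpow_pos.le
  have h25 : (2 * ((r : ℝ) + 1) + 1) ^ 2 ≤ 25 * (r : ℝ) ^ (2 : ℝ) := by
    rw [Real.rpow_two]; nlinarith
  have hsplit : (r : ℝ) ^ (2 : ℝ) * (r : ℝ) ^ (-(5 / 2 + κ)) = ((r : ℝ) ^ (1 / 2 + κ))⁻¹ := by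
    rw [← Real.rpow_add hr0, ← Real.rpow_neg hr0.le]; congr 1; ring
  have hpow_pos : 0 < (r : ℝ) ^ (1 / 2 + κ) := Real.rpow_pos_of_pos hr0 _
  have key : p ≤ 900 * |C| * ((r : ℝ) ^ (1 / 2 + κ))⁻¹ := by
    have h1 := hup.trans hC
    rw [div_le_iff₀ (by positivity)] at h1
    calc p ≤ |C| * (r : ℝ) ^ (-(5 / 2 + κ)) * (36 * (2 * ((r : ℝ) + 1) + 1) ^ 2) := h1
      _ ≤ |C| * (r : ℝ) ^ (-(5 / 2 + κ)) * (36 * (25 * (r : ℝ) ^ (2 : ℝ))) := by gcongr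
      _ = 900 * |C| * ((r : ℝ) ^ (2 : ℝ) * (r : ℝ) ^ (-(5 / 2 + κ))) := by ring
      _ = 900 * |C| * ((r : ℝ) ^ (1 / 2 + κ))⁻¹ := by rw [hsplit]
  rw [← div_eq_mul_inv, le_div_iff₀ hpow_pos] at key
  -- key : p * r^{1/2+κ} ≤ 900 |C| ; hr : 900|C|/p < r^{1/2+κ}
  rw [div_lt_iff₀ hpc0] at hr
  linarith [mul_comm p ((r : ℝ) ^ (1 / 2 + κ))]

/-! # Part 3: the SECOND arm is load-bearing (landing as `Negative/SecondArm.lean`) -/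


/-! ## A path lemma: avoid a vertex or take the last exit from it -/

/-- **Last exit.** A `G`-path inside `S` from `u ≠ x` to `v ≠ x` either stays inside `S ∖ {x}`, or some
neighbour `w` of `x` is joined to `v` inside `S ∖ {x}` (the tail after the last visit to `x`). -/
theorem pathIn_avoid_or_lastExit {V : Type*} {G : SimpleGraph V} {S : Set V} {u v x : V}
    (h : PathIn G S u v) (hu : u ≠ x) (hv : v ≠ x) :
    PathIn G (S \ {x}) u v ∨ ∃ w, G.Adj x w ∧ PathIn G (S \ {x}) w v := by
  obtain ⟨huS, hr⟩ := h
  suffices key : ∀ v, Relation.ReflTransGen (fun a b => G.Adj a b ∧ b ∈ S) u v → v ≠ x →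
      PathIn G (S \ {x}) u v ∨ ∃ w, G.Adj x w ∧ PathIn G (S \ {x}) w v from key v hr hv
  intro v hr
  induction hr with
  | refl => intro hux; exact Or.inl (PathIn.refl (Set.mem_sdiff_singleton.2 ⟨huS, hux⟩))
  | @tail b c _ hbc ih =>
    intro hcx
    by_cases hbx : b = x
    · subst hbx
      exact Or.inr ⟨c, hbc.1, PathIn.refl (Set.mem_sdiff_singleton.2 ⟨hbc.2, hcx⟩)⟩
    · rcases ih hbx with h1 | ⟨w, hxw, hwb⟩
      · exact Or.inl (h1.tail hbc.1 (Set.mem_sdiff_singleton.2 ⟨hbc.2, hcx⟩))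
      · exact Or.inr ⟨w, hxw, hwb.tail hbc.1 (Set.mem_sdiff_singleton.2 ⟨hbc.2, hcx⟩)⟩

/-! ## Stars and isolation -/

/-- The six lattice edges at a site `c` of `ℤ³`. -/
def starAt (c : Site 3) : Finset (Sym2 (Site 3)) :=
  Finset.univ.image (fun i : Fin 3 => s(c, c + Pi.single i 1)) ∪
    Finset.univ.image (fun i : Fin 3 => s(c, c - Pi.single i 1))

/-- A lattice edge at `c` belongs to `starAt c`. -/
theorem mem_starAt_of_adj {c v : Site 3} (h : (zdGraph 3).Adj c v) : s(c, v) ∈ starAt c := by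
  obtain ⟨i, hv | hv⟩ := (zdGraph_adj_iff c v).1 h
  · rw [hv]
    exact Finset.mem_union.2 (Or.inl (Finset.mem_image_of_mem _ (Finset.mem_univ i)))
  · have : v = c - Pi.single i 1 := eq_sub_of_add_eq hv.symm
    rw [this]
    exact Finset.mem_union.2 (Or.inr (Finset.mem_image_of_mem _ (Finset.mem_univ i)))

/-- Closing the star of `c` isolates `c`: no open path inside any `S` joins `c` to `y ≠ c`
(for configurations using lattice edges only). -/
theorem not_openConnIn_of_starAt_closed {ω : BondConfig (Site 3)} (hω : ω ⊆ (zdGraph 3).edgeSet)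
    {c : Site 3} (hc : ∀ f ∈ starAt c, f ∉ ω) {S : Set (Site 3)} {y : Site 3} (hy : y ≠ c) :
    ω ∉ openConnIn S c y := by
  intro h
  have hp := pathIn_of_mem_openConnIn h
  have key : y = c := by
    refine pathIn_induction (fun v => v = c) hp rfl ?_
    intro a b _ _ hac hab
    rw [hac] at hab
    have h1 := (openGraph_adj _ _ _).1 hab
    have hadj : (zdGraph 3).Adj c b := by simpa [SimpleGraph.mem_edgeSet] using hω h1.1
    exact (hc _ (mem_starAt_of_adj hadj) h1.1).elim
  exact hy key

/-! ## The `e`-avoiding half-box and the detour -/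

/-- The half-box with the root `e` removed. -/
def avoidBox (r : ℕ) : Finset (Site 3) := (halfBox r).erase e

/-- The `e`-avoiding finite-volume arm event. -/
def armAvoid (r : ℕ) : Set (BondConfig (Site 3)) := openCrossing (↑(avoidBox r)) {0} (far r)

/-- `↑(avoidBox r) = ↑(halfBox r) ∖ {e}`. -/
theorem coe_avoidBox (r : ℕ) : (↑(avoidBox r) : Set (Site 3)) = ↑(halfBox r) \ {e} := by
  rw [avoidBox, Finset.coe_erase]

/-- Small sites of `H` other than `e` lie in the avoiding box once `r ≥ 1`. -/
theorem mem_avoidBox_of_small {r : ℕ} (hr : 1 ≤ r) {v : Site 3} (h0 : 0 ≤ v 0)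
    (hv : ∀ i, |v i| ≤ 2) (hne : v ≠ e) : v ∈ (↑(avoidBox r) : Set (Site 3)) := by
  rw [coe_avoidBox]
  refine Set.mem_sdiff_singleton.2 ⟨?_, hne⟩
  rw [Finset.mem_coe, halfBox, Finset.mem_filter, mem_box]
  refine ⟨fun i => ?_, h0⟩
  have := hv i
  rw [abs_le] at this
  push_cast
  omega

/-- Eight lattice edges forming detours inside `H ∖ {e}` from `0` to the `H`-neighbours of `e`:
`0–(0,0,1)–(0,1,1)–(0,2,1)–(0,2,0)`, `0–(0,0,-1)–(0,1,-1)`, `0–(1,0,0)–(1,1,0)`. -/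
def detour : Finset (Sym2 (Site 3)) :=
  {s((0 : Site 3), ![0, 0, 1]), s((![0, 0, 1] : Site 3), ![0, 1, 1]), s((![0, 1, 1] : Site 3), ![0, 2, 1]),
    s((![0, 2, 1] : Site 3), ![0, 2, 0]), s((0 : Site 3), ![0, 0, -1]), s((![0, 0, -1] : Site 3), ![0, 1, -1]),
    s((0 : Site 3), ![1, 0, 0]), s((![1, 0, 0] : Site 3), ![1, 1, 0])}

/-- The detour edges are lattice edges. -/
theorem detour_subset_edgeSet : (↑detour : Set (Sym2 (Site 3))) ⊆ (zdGraph 3).edgeSet := by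
  intro f hf
  simp only [detour, Finset.coe_insert, Finset.coe_singleton, Set.mem_insert_iff,
    Set.mem_singleton_iff] at hf
  rcases hf with rfl | rfl | rfl | rfl | rfl | rfl | rfl | rfl <;>
    exact (SimpleGraph.mem_edgeSet _).2 (by decide)

/-- `e = (0,1,0)` in vector notation. -/
theorem e_eq_vec : e = ![0, 1, 0] := by decide

/-- One detour step: an edge of `detour` between sites of the avoiding box is an open step of
`openGraph (ω ∪ detour)`. -/
theorem detour_step {ω : BondConfig (Site 3)} {u v : Site 3} (huv : s(u, v) ∈ detour) (hne : u ≠ v) :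
    (openGraph (ω ∪ ↑detour)).Adj u v :=
  (openGraph_adj _ _ _).2 ⟨Set.mem_union_right _ (Finset.mem_coe.2 huv), hne⟩

/-- **Detours.** For every `H`-neighbour `w` of `e` inside the avoiding box there is an open path of
`ω ∪ detour` from `0` to `w` inside the avoiding box (`r ≥ 1`). -/
theorem detourPath {r : ℕ} (hr : 1 ≤ r) (ω : BondConfig (Site 3)) {w : Site 3}
    (hw : (zdGraph 3).Adj e w) (hwA : w ∈ (↑(avoidBox r) : Set (Site 3))) :
    PathIn (openGraph (ω ∪ ↑detour)) (↑(avoidBox r)) 0 w := by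
  have h0 : (0 : Site 3) ∈ (↑(avoidBox r) : Set (Site 3)) :=
    mem_avoidBox_of_small hr (by decide) (by decide) (by decide)
  have ha1 : (![0, 0, 1] : Site 3) ∈ (↑(avoidBox r) : Set (Site 3)) :=
    mem_avoidBox_of_small hr (by decide) (by decide) (by decide)
  have ha2 : (![0, 1, 1] : Site 3) ∈ (↑(avoidBox r) : Set (Site 3)) :=
    mem_avoidBox_of_small hr (by decide) (by decide) (by decide)
  have ha3 : (![0, 2, 1] : Site 3) ∈ (↑(avoidBox r) : Set (Site 3)) :=
    mem_avoidBox_of_small hr (by decide) (by decide) (by decide)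
  have ha4 : (![0, 2, 0] : Site 3) ∈ (↑(avoidBox r) : Set (Site 3)) :=
    mem_avoidBox_of_small hr (by decide) (by decide) (by decide)
  have hb1 : (![0, 0, -1] : Site 3) ∈ (↑(avoidBox r) : Set (Site 3)) :=
    mem_avoidBox_of_small hr (by decide) (by decide) (by decide)
  have hb2 : (![0, 1, -1] : Site 3) ∈ (↑(avoidBox r) : Set (Site 3)) :=
    mem_avoidBox_of_small hr (by decide) (by decide) (by decide)
  have hc1 : (![1, 0, 0] : Site 3) ∈ (↑(avoidBox r) : Set (Site 3)) :=
    mem_avoidBox_of_small hr (by decide) (by decide) (by decide)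
  have hc2 : (![1, 1, 0] : Site 3) ∈ (↑(avoidBox r) : Set (Site 3)) :=
    mem_avoidBox_of_small hr (by decide) (by decide) (by decide)
  -- the paths
  have pA1 : PathIn (openGraph (ω ∪ ↑detour)) (↑(avoidBox r)) 0 ![0, 0, 1] :=
    (PathIn.refl h0).tail (detour_step (by decide) (by decide)) ha1
  have pA2 : PathIn (openGraph (ω ∪ ↑detour)) (↑(avoidBox r)) 0 ![0, 1, 1] :=
    pA1.tail (detour_step (by decide) (by decide)) ha2
  have pA4 : PathIn (openGraph (ω ∪ ↑detour)) (↑(avoidBox r)) 0 ![0, 2, 0] :=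
    (pA2.tail (detour_step (by decide) (by decide)) ha3).tail (detour_step (by decide) (by decide)) ha4
  have pB2 : PathIn (openGraph (ω ∪ ↑detour)) (↑(avoidBox r)) 0 ![0, 1, -1] :=
    ((PathIn.refl h0).tail (detour_step (by decide) (by decide)) hb1).tail
      (detour_step (by decide) (by decide)) hb2
  have pC2 : PathIn (openGraph (ω ∪ ↑detour)) (↑(avoidBox r)) 0 ![1, 1, 0] :=
    ((PathIn.refl h0).tail (detour_step (by decide) (by decide)) hc1).tail
      (detour_step (by decide) (by decide)) hc2
  -- enumerate the neighbours of e
  obtain ⟨i, hi | hi⟩ := (zdGraph_adj_iff e w).1 hw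
  · fin_cases i
    · have : w = ![1, 1, 0] := by rw [hi]; decide
      rw [this]; exact pC2
    · have : w = ![0, 2, 0] := by rw [hi]; decide
      rw [this]; exact pA4
    · have : w = ![0, 1, 1] := by rw [hi]; decide
      rw [this]; exact pA2
  · have hw' : w = e - Pi.single i 1 := eq_sub_of_add_eq hi.symm
    fin_cases i
    · -- w = (-1,1,0) is not in H
      exfalso
      have : w = ![-1, 1, 0] := by rw [hw']; decide
      rw [this, coe_avoidBox] at hwA
      have h2 := (Set.mem_sdiff_singleton.1 hwA).1
      rw [Finset.mem_coe, halfBox, Finset.mem_filter] at h2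
      have h3 := h2.2
      simp at h3
    · have : w = 0 := by rw [hw']; decide
      rw [this]; exact PathIn.refl h0
    · have : w = ![0, 1, -1] := by rw [hw']; decide
      rw [this]; exact pB2

/-- **Opening the detour reroutes the arm around `e`.** For `r ≥ 2` and `ω` using lattice edges only,
`ω ∈ armBox r` implies `ω ∪ detour ∈ armAvoid r`. -/
theorem openEdges_detour_mem_armAvoid {r : ℕ} (hr : 2 ≤ r) {ω : BondConfig (Site 3)}
    (hω : ω ⊆ (zdGraph 3).edgeSet) (h : ω ∈ armBox r) : ω ∪ ↑detour ∈ armAvoid r := by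
  obtain ⟨a, ha, b, hb, hab⟩ := h
  rw [Set.mem_singleton_iff] at ha
  subst ha
  have hbe : b ≠ e := by
    rintro rfl
    obtain ⟨i, hi⟩ := hb
    have : |e i| ≤ 1 := by
      rw [e_eq_vec]; fin_cases i <;> simp
    omega
  have he0 : (0 : Site 3) ≠ e := by decide
  have hp : PathIn (openGraph (ω ∪ ↑detour)) (↑(halfBox r)) 0 b :=
    (pathIn_of_mem_openConnIn hab).mono_graph (openGraph_mono Set.subset_union_left)
  rcases pathIn_avoid_or_lastExit hp he0 hbe with h1 | ⟨w, hew, hwb⟩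
  · refine ⟨0, rfl, b, hb, mem_openConnIn_of_pathIn ?_⟩
    rwa [coe_avoidBox]
  · have hω' : ω ∪ ↑detour ⊆ (zdGraph 3).edgeSet := Set.union_subset hω detour_subset_edgeSet
    have hadj : (zdGraph 3).Adj e w := by
      have := (openGraph_adj _ _ _).1 hew
      simpa [SimpleGraph.mem_edgeSet] using hω' this.1
    rw [← coe_avoidBox] at hwb
    have hwA : w ∈ (↑(avoidBox r) : Set (Site 3)) := hwb.left_mem
    exact ⟨0, rfl, b, hb, mem_openConnIn_of_pathIn ((detourPath (by omega) ω hadj hwA).trans hwb)⟩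

/-! ## Probabilities -/

/-- `armAvoid r` is measurable. -/
theorem measurableSet_armAvoid (r : ℕ) : MeasurableSet (armAvoid r) := by
  have h : armAvoid r = ⋃ y ∈ far r, openConnIn (↑(avoidBox r) : Set (Site 3)) 0 y := by
    ext ω; simp [armAvoid, openCrossing]
  rw [h]
  exact MeasurableSet.biUnion (Set.to_countable _) fun y _ => measurableSet_openConnIn (avoidBox r) 0 y

/-- `armAvoid r` is determined by the pairs of sites of the avoiding box. -/
theorem determinedBy_armAvoid (r : ℕ) :
    DeterminedBy (armAvoid r) (↑(avoidBox r).sym2 : Set (Sym2 (Site 3))) := by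
  rw [determinedBy_iff]
  intro ω ω' hω
  have hK : ∀ y, (ω ∈ openConnIn (↑(avoidBox r) : Set (Site 3)) 0 y ↔
      ω' ∈ openConnIn (↑(avoidBox r) : Set (Site 3)) 0 y) := fun y =>
    (determinedBy_iff _ _).1 (determinedBy_openConnIn (↑(avoidBox r) : Set (Site 3)) 0 y
      (K := ↑(avoidBox r).sym2) (by rw [Finset.coe_sym2])) ω ω' hω
  simp only [armAvoid, mem_openCrossing_iff, Set.mem_singleton_iff]
  constructor
  · rintro ⟨a, rfl, y, hy, h⟩; exact ⟨0, rfl, y, hy, (hK y).1 h⟩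
  · rintro ⟨a, rfl, y, hy, h⟩; exact ⟨0, rfl, y, hy, (hK y).2 h⟩

/-- **The avoiding arm is not rare**: `P(armAvoid r) ≥ p_c^8 / (36 (2r+1)²)` for `r ≥ 2`
(insertion tolerance for the detour + `armBox_ge`). -/
theorem armAvoid_ge {r : ℕ} (hr : 2 ≤ r) :
    ((criticalProbI 3 : unitInterval) : ℝ) ^ detour.card / (36 * (2 * (r : ℝ) + 1) ^ 2) ≤
      μ.real (armAvoid r) := by
  have h1 := bondPercolation_pow_mul_real_preimage_openEdges_le (zdGraph 3) (criticalProbI 3) detour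
    detour_subset_edgeSet (measurableSet_armAvoid r)
  have h2 : μ.real (armBox r) ≤ μ.real (openEdges ↑detour ⁻¹' armAvoid r) :=
    real_mono_of_forall_subset_edgeSet (zdGraph 3) _ fun ω hω h =>
      openEdges_detour_mem_armAvoid hr hω h
  have h3 := armBox_ge r
  have hp0 : 0 ≤ ((criticalProbI 3 : unitInterval) : ℝ) ^ detour.card := pow_nonneg (criticalProbI 3).2.1 _
  calc ((criticalProbI 3 : unitInterval) : ℝ) ^ detour.card / (36 * (2 * (r : ℝ) + 1) ^ 2)
      = ((criticalProbI 3 : unitInterval) : ℝ) ^ detour.card * (1 / (36 * (2 * (r : ℝ) + 1) ^ 2)) := by ring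
    _ ≤ ((criticalProbI 3 : unitInterval) : ℝ) ^ detour.card * μ.real (openEdges ↑detour ⁻¹' armAvoid r) :=
        mul_le_mul_of_nonneg_left (h3.trans h2) hp0
    _ ≤ μ.real (armAvoid r) := h1

/-- The crux event with the SECOND arm dropped: `C_H(0)` reaches distance `r` and `0 ↮_H e`. -/
def E'' (r : ℕ) : Set (BondConfig (Site 3)) :=
  {ω | (∃ y : Site 3, (∃ i : Fin 3, (r : ℤ) ≤ |y i|) ∧ ω ∈ openConnIn H 0 y) ∧ ω ∉ openConnIn H 0 e}

/-- The avoiding box lies in `H`. -/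
theorem avoidBox_subset_H (r : ℕ) : (↑(avoidBox r) : Set (Site 3)) ⊆ H := by
  rw [coe_avoidBox]; exact Set.sdiff_subset.trans (halfBox_subset_H r)

/-- `armAvoid r ∩ {star of e closed} ⊆ E'' r` for configurations on lattice edges. -/
theorem mem_E''_of_armAvoid_of_star_closed {r : ℕ} {ω : BondConfig (Site 3)} (hω : ω ⊆ (zdGraph 3).edgeSet)
    (h : ω ∈ armAvoid r ∩ {ω | ∀ f ∈ starAt e, f ∉ ω}) : ω ∈ E'' r := by
  obtain ⟨⟨a, ha, y, hy, hay⟩, hstar⟩ := h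
  rw [Set.mem_singleton_iff] at ha
  subst ha
  refine ⟨⟨y, hy, openConnIn_mono' (avoidBox_subset_H r) _ _ hay⟩, ?_⟩
  rw [openConnIn_comm']
  exact not_openConnIn_of_starAt_closed hω hstar (by decide)

/-- The star of `e` avoids the pairs of the avoiding box. -/
theorem disjoint_sym2_starAt (r : ℕ) :
    Disjoint (↑(avoidBox r).sym2 : Set (Sym2 (Site 3))) ↑(starAt e) := by
  rw [Set.disjoint_right]
  intro f hf hK
  rw [Finset.mem_coe, starAt, Finset.mem_union, Finset.mem_image, Finset.mem_image] at hf
  have he : e ∉ avoidBox r := Finset.notMem_erase e _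
  rcases hf with ⟨i, -, rfl⟩ | ⟨i, -, rfl⟩ <;>
    · rw [Finset.mem_coe, Finset.mk_mem_sym2_iff] at hK
      exact he hK.1

/-- **Lower bound for the one-sided event**: for `r ≥ 2`,
`P(E'' r) ≥ (1 - p_c)^{|star e|} p_c^{|detour|} / (36 (2r+1)²)`. -/
theorem real_E''_ge {r : ℕ} (hr : 2 ≤ r) :
    (1 - ((criticalProbI 3 : unitInterval) : ℝ)) ^ (starAt e).card *
        (((criticalProbI 3 : unitInterval) : ℝ) ^ detour.card / (36 * (2 * (r : ℝ) + 1) ^ 2)) ≤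
      μ.real (E'' r) := by
  set C : Set (BondConfig (Site 3)) := {ω | ∀ f ∈ starAt e, f ∉ ω} with hC
  have hind : μ.real (armAvoid r ∩ C) = μ.real (armAvoid r) * μ.real C :=
    bondPercolation_real_inter_of_disjoint (zdGraph 3) (criticalProbI 3) (disjoint_sym2_starAt r)
      (determinedBy_armAvoid r) (determinedBy_forall_notMem (starAt e)) (measurableSet_armAvoid r)
      (measurableSet_forall_notMem (starAt e))
  have hCge : (1 - ((criticalProbI 3 : unitInterval) : ℝ)) ^ (starAt e).card ≤ μ.real C :=
    le_bondPercolation_real_forall_notMem (zdGraph 3) (criticalProbI 3) (starAt e)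
  have hA := armAvoid_ge hr
  have hsub : μ.real (armAvoid r ∩ C) ≤ μ.real (E'' r) :=
    real_mono_of_forall_subset_edgeSet (zdGraph 3) _ fun ω hω h =>
      mem_E''_of_armAvoid_of_star_closed hω h
  have hq0 : 0 ≤ ((criticalProbI 3 : unitInterval) : ℝ) ^ detour.card / (36 * (2 * (r : ℝ) + 1) ^ 2) :=
    div_nonneg (pow_nonneg (criticalProbI 3).2.1 _) (by positivity)
  calc (1 - ((criticalProbI 3 : unitInterval) : ℝ)) ^ (starAt e).card *
        (((criticalProbI 3 : unitInterval) : ℝ) ^ detour.card / (36 * (2 * (r : ℝ) + 1) ^ 2))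
      ≤ μ.real C * μ.real (armAvoid r) :=
        mul_le_mul hCge hA hq0 measureReal_nonneg
    _ = μ.real (armAvoid r ∩ C) := by rw [hind, mul_comm]
    _ ≤ μ.real (E'' r) := hsub

/-- **No power decay beyond 2 from an inverse-square lower bound** (the arithmetic shared by the
one-sided refutations): if `f r ≥ c/(36(2r+1)²)` for `r ≥ 2` with `c > 0`, then `f` is not
`O(r^{-(5/2+κ)})` on `r ≥ 1` for any `κ > 0`. -/
theorem not_decay_of_inv_sq_lower {f : ℕ → ℝ} {c : ℝ} (hc : 0 < c)
    (hlow : ∀ r : ℕ, 2 ≤ r → c / (36 * (2 * (r : ℝ) + 1) ^ 2) ≤ f r) :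
    ¬ ∃ κ C : ℝ, 0 < κ ∧ ∀ r : ℕ, 1 ≤ r → f r ≤ C * (r : ℝ) ^ (-(5 / 2 + κ)) := by
  rintro ⟨κ, C, hκ, h⟩
  have hb : 0 < 1 / 2 + κ := by linarith
  have hM0 : 0 ≤ 324 * |C| / c := div_nonneg (by positivity) hc.le
  obtain ⟨r, hr1, hr⟩ := exists_nat_rpow_gt hb (324 * |C| / c + 1)
  have hr2 : 2 ≤ r := by
    by_contra hlt
    have : r = 1 := by omega
    subst this
    simp at hr
    linarith
  have hr0 : (0 : ℝ) < r := by exact_mod_cast (show 0 < r by omega)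
  have hr1' : (1 : ℝ) ≤ r := by exact_mod_cast hr1
  have hup := (hlow r hr2).trans (h r hr1)
  have hrpow_pos : 0 < (r : ℝ) ^ (-(5 / 2 + κ)) := Real.rpow_pos_of_pos hr0 _
  have hCabs : C * (r : ℝ) ^ (-(5 / 2 + κ)) ≤ |C| * (r : ℝ) ^ (-(5 / 2 + κ)) :=
    mul_le_mul_of_nonneg_right (le_abs_self C) hrpow_pos.le
  have h9 : (2 * (r : ℝ) + 1) ^ 2 ≤ 9 * (r : ℝ) ^ (2 : ℝ) := by
    rw [Real.rpow_two]; nlinarith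
  have hsplit : (r : ℝ) ^ (2 : ℝ) * (r : ℝ) ^ (-(5 / 2 + κ)) = ((r : ℝ) ^ (1 / 2 + κ))⁻¹ := by
    rw [← Real.rpow_add hr0, ← Real.rpow_neg hr0.le]; congr 1; ring
  have hpow_pos : 0 < (r : ℝ) ^ (1 / 2 + κ) := Real.rpow_pos_of_pos hr0 _
  have key : c ≤ 324 * |C| * ((r : ℝ) ^ (1 / 2 + κ))⁻¹ := by
    have h1 := hup.trans hCabs
    rw [div_le_iff₀ (by positivity)] at h1
    calc c ≤ |C| * (r : ℝ) ^ (-(5 / 2 + κ)) * (36 * (2 * (r : ℝ) + 1) ^ 2) := h1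
      _ ≤ |C| * (r : ℝ) ^ (-(5 / 2 + κ)) * (36 * (9 * (r : ℝ) ^ (2 : ℝ))) := by gcongr
      _ = 324 * |C| * ((r : ℝ) ^ (2 : ℝ) * (r : ℝ) ^ (-(5 / 2 + κ))) := by ring
      _ = 324 * |C| * ((r : ℝ) ^ (1 / 2 + κ))⁻¹ := by rw [hsplit]
  rw [← div_eq_mul_inv, le_div_iff₀ hpow_pos] at key
  -- key : c * r^{1/2+κ} ≤ 324 |C| ;  hr : 324|C|/c + 1 < r^{1/2+κ}
  have hr' : 324 * |C| / c < (r : ℝ) ^ (1 / 2 + κ) := by linarith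
  rw [div_lt_iff₀ hc] at hr'
  linarith [mul_comm c ((r : ℝ) ^ (1 / 2 + κ))]

/-- **The second arm is load-bearing**: dropping "`C_H(e)` reaches distance `r`" from the crux makes it
FALSE.  (The landed twin `boundaryTwoArmDecay_false_without_disjoint` drops the disjointness instead.) -/
theorem boundaryTwoArmDecay_false_without_second_arm :
    ¬ ∃ κ C : ℝ, 0 < κ ∧ ∀ r : ℕ, 1 ≤ r → μ.real (E'' r) ≤ C * (r : ℝ) ^ (-(5 / 2 + κ)) := by
  have hpc := Grimmett1999_criticalProb_pos_lt_one_holds 3 (by norm_num)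
  have hpc0 : 0 < ((criticalProbI 3 : unitInterval) : ℝ) := hpc.1
  have hpc1 : ((criticalProbI 3 : unitInterval) : ℝ) < 1 := hpc.2
  refine not_decay_of_inv_sq_lower (c := (1 - ((criticalProbI 3 : unitInterval) : ℝ)) ^ (starAt e).card *
    ((criticalProbI 3 : unitInterval) : ℝ) ^ detour.card) (mul_pos (pow_pos (by linarith) _) (pow_pos hpc0 _)) ?_
  intro r hr
  have := real_E''_ge hr
  rwa [mul_div_assoc]

end

end Summit.CriticalPhenomena.PercolationContinuityZ3.Cruxes.BoundaryTwoArmDecay.Disproof
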